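import Mathlib
import Summits.NavierStokesRegularity.NavierStokesRegularity.Theorems.ThreadingFluxAzimuthalCartanConicalHead
import HarnessLib

/-!
# Crux `PoloidalLiouville` (stmt-NavierStokesRegularity-1222, wall W1), crux idea «azimuthal-cartan-test» (ns-idea-15 g10):
# THE RATIONAL SLEZKIN CONE FLOWS `u_β` — KINEMATICS (derivative, `div u = 0`, curl, unthreaded, `(−1)`-homogeneous, `Δu`)

Support file (`--supports stmt-NavierStokesRegularity-1222`, helper; cell `ns-wall-extremal`, width hand ns-wall-eng-6 g7, 0 kit).
A SCOPE RESULT for the conical method (director-ns g19 p115): an explicit steady `(−1)`-homogeneous unthreaded Navier–Stokes family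
outside the image of the conformal correspondence.  This file: the field and its first-order calculus; the sequel
`ThreadingFluxAzimuthalCartanConicalSlezkinWitness.lean`: pressure, steady NS, Šverák's head, and the non-membership theorem.

For every real `β` the RATIONAL field
`u_β(x) = ((2−β)x₀/ρ² − 2x₀/x₂², (2−β)x₁/ρ² − 2x₁/x₂², −4/x₂)`, `ρ² = x₀² + x₁²`,
lives on the open cone `slezkinCone = {x₂ ≠ 0, ρ ≠ 0}` (space minus the horizontal plane and the vertical axis).  In spherical terms it
is the member `ψ = r(β cos θ − 2/cos θ)` of Slezkin's 1934 family of `(−1)`-homogeneous axisymmetric no-swirl flows (Stokes stream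
function `ψ = r y(cos θ)`, `y` solving the Riccati equation `(1−ξ²)y′ + 2ξy − ½y² = c₁ξ² + c₂ξ + c₃`; the Landau solutions are the
members smooth on `S²`; `β = 2` here is the most singular Landau member `y = 2(1−ξ²)/(0 − ξ)`); in Cartesian form `u_β = u₀ − β∇log ρ`,
tangential part `∇(2 log tan θ − β log sin θ)`, vorticity `(4/x₂³)(−x₁, x₀, 0)` (azimuthal: the flow is UNTHREADED about the vertex).

Proved here by explicit calculus (first derivatives by hand; `Δu = −curl curl u` through the LOCAL identity of
`ThreadingFluxAzimuthalCartanLocalCurlCurl.lean`, no second derivatives of `u` computed):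
`isOpen_slezkinCone`; `hasFDerivAt_slezkinField`, `fderiv_slezkinField_apply(_zero/_one/_two)`; `divergence_slezkinField = 0`;
`curl_slezkinField`; ★ `inner_self_curl_slezkinField` (UNTHREADED about `0`); `curl_slezkinField_ne_zero` (rotational at every point
of the cone); ★ `fderiv_slezkinField_apply_self` (`Du_β(x)x = −u_β(x)`: HOMOGENEOUS of degree `−1`); `curl_slezkinVort`;
`analyticAt_slezkinField`; `laplacian_slezkinField` (`Δu_β = −(12x₀/x₂⁴, 12x₁/x₂⁴, 8/x₂³)`).

HONEST FRAME: explicit steady local vector calculus strictly below W1; closes no Prop of the sketch; `PoloidalLiouville` (1222) and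
NS regularity are OPEN / NOT proved.  (A local CAS script checked the identities numerically before typing — not cited; the file of
record is the kernel.)

## References
* N. A. Slezkin, Uch. zap. MGU 2 (1934) 89–90; L. D. Landau, Dokl. Akad. Nauk SSSR 43 (1944) 286–288; H. B. Squire, Quart. J. Mech. Appl.
  Math. 4 (1951) 321–329. [folklore: the axisymmetric conical family]
* V. Šverák, J. Math. Sci. 179 (2011) 208–228, arXiv:math/0604550, §4. [Sverak2011]
* L. Li, Y. Y. Li, X. Yan, arXiv:1609.08197, arXiv:1704.08730 (local conical families beyond Landau).
-/

-- the summit and its single sub-problem share the name (CONVENTIONS §1)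
set_option linter.dupNamespace false

noncomputable section

namespace Summit.NavierStokesRegularity.NavierStokesRegularity.Theorems.PoloidalLiouville.AzimuthalCartan

open Set Function Filter Topology Metric
open scoped ContDiff RealInnerProductSpace
open Literature.Analysis.FluidPDE (curl divergence_eq_sum_inner_fderiv)
open Summit.NavierStokesRegularity.NavierStokesRegularity.Theorems.PoloidalLiouville.CentreJet (E3 IsSteadyNSOn)
open Summit.NavierStokesRegularity.NavierStokesRegularity.Theorems.RotatingEulerWindowProfileLinearRung (hasFDerivAt_coord)
open Summit.NavierStokesRegularity.NavierStokesRegularity.Theorems.PoloidalLiouville.AzimuthalCartan.HalfSpace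
  (proj_apply' analyticAt_coord hasFDerivAt_div hasFDerivAt_cylSq analyticAt_cylSq)

/-! ### The objects -/

/-- The open cone `{x₂ ≠ 0, x₀² + x₁² ≠ 0}`: space minus the horizontal plane and the vertical axis. -/
def slezkinCone : Set E3 := {x | x 2 ≠ 0 ∧ x 0 ^ 2 + x 1 ^ 2 ≠ 0}

/-- The planar coefficient `c_β = (2 − β)/ρ² − 2/x₂²` of the Slezkin flow. -/
def slezkinCoeff (β : ℝ) (x : E3) : ℝ := (2 - β) / (x 0 ^ 2 + x 1 ^ 2) - 2 / x 2 ^ 2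

/-- THE RATIONAL SLEZKIN CONE FLOW `u_β = (c_β x₀, c_β x₁, −4/x₂)` (stream function `ψ = r(β cos θ − 2/cos θ)`). [Slezkin 1934 family] -/
def slezkinField (β : ℝ) : E3 → E3 := fun x =>
  (slezkinCoeff β x * x 0) • (EuclideanSpace.single 0 (1 : ℝ) : E3) + (slezkinCoeff β x * x 1) • (EuclideanSpace.single 1 (1 : ℝ) : E3) +
    (-4 / x 2) • (EuclideanSpace.single 2 (1 : ℝ) : E3)

/-- Its pressure `p_β = −(β − 2)²/(2ρ²) − 4/x₂²` (homogeneous of degree `−2`). -/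
def slezkinPressure (β : ℝ) : E3 → ℝ := fun x => -((β - 2) ^ 2 / (2 * (x 0 ^ 2 + x 1 ^ 2))) - 4 / x 2 ^ 2

/-- The differential of the planar coefficient: `Dc_β = −(2(2−β)/ρ⁴)(x₀dx₀ + x₁dx₁) + (4/x₂³)dx₂`. -/
def dCoeff (β : ℝ) (x : E3) : E3 →L[ℝ] ℝ :=
  (-(2 * (2 - β)) / (x 0 ^ 2 + x 1 ^ 2) ^ 2) • ((x 0) • (EuclideanSpace.proj 0 : E3 →L[ℝ] ℝ) + (x 1) • (EuclideanSpace.proj 1 : E3 →L[ℝ] ℝ)) +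
    (4 / x 2 ^ 3) • (EuclideanSpace.proj 2 : E3 →L[ℝ] ℝ)

variable (β : ℝ) {x : E3}

/-- The cone is open. -/
theorem isOpen_slezkinCone : IsOpen slezkinCone := by
  have h2 : Continuous fun x : E3 => x 2 := continuous_apply 2 |>.comp (PiLp.continuous_ofLp 2 _)
  have hs : Continuous fun x : E3 => x 0 ^ 2 + x 1 ^ 2 :=
    ((continuous_apply 0 |>.comp (PiLp.continuous_ofLp 2 _)).pow 2).add ((continuous_apply 1 |>.comp (PiLp.continuous_ofLp 2 _)).pow 2)
  exact (isOpen_ne_fun h2 continuous_const).inter (isOpen_ne_fun hs continuous_const)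

/-- Components of the Slezkin flow. -/
theorem slezkinField_apply_zero (y : E3) : slezkinField β y 0 = slezkinCoeff β y * y 0 := by
  simp [slezkinField]

/-- Second component. -/
theorem slezkinField_apply_one (y : E3) : slezkinField β y 1 = slezkinCoeff β y * y 1 := by
  simp [slezkinField]

/-- Third component. -/
theorem slezkinField_apply_two (y : E3) : slezkinField β y 2 = -4 / y 2 := by
  simp [slezkinField]

/-! ### First derivatives -/

/-- The derivative of the planar coefficient. -/
theorem hasFDerivAt_slezkinCoeff (hx : x ∈ slezkinCone) : HasFDerivAt (slezkinCoeff β) (dCoeff β x) x := by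
  obtain ⟨hz, hρ⟩ := hx
  have h1 := hasFDerivAt_div (hasFDerivAt_const (2 - β) x) (hasFDerivAt_cylSq x) hρ
  have hz2 : x 2 ^ 2 ≠ 0 := pow_ne_zero 2 hz
  have h2 := hasFDerivAt_div (hasFDerivAt_const (2 : ℝ) x) ((hasFDerivAt_coord 2 x).pow 2) hz2
  refine ((h1.sub h2).congr_fderiv ?_).congr_of_eventuallyEq (Eventually.of_forall fun y => rfl)
  ext v
  simp only [dCoeff, add_apply, sub_apply, smul_apply, smul_eq_mul,
    proj_apply', zero_apply]
  simp
  field_simp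
  ring

/-- The derivative of the planar components `c_β xᵢ` (`i = 0, 1`). -/
theorem hasFDerivAt_slezkinPlanar (hx : x ∈ slezkinCone) (i : Fin 3) :
    HasFDerivAt (fun y : E3 => slezkinCoeff β y * y i)
      (slezkinCoeff β x • (EuclideanSpace.proj i : E3 →L[ℝ] ℝ) + (x i) • dCoeff β x) x :=
  (hasFDerivAt_slezkinCoeff β hx).mul (hasFDerivAt_coord i x)

/-- The derivative of the vertical component `−4/x₂`. -/
theorem hasFDerivAt_slezkinVertical (hx : x ∈ slezkinCone) :
    HasFDerivAt (fun y : E3 => -4 / y 2) ((4 / x 2 ^ 2) • (EuclideanSpace.proj 2 : E3 →L[ℝ] ℝ)) x := by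
  have h := hasFDerivAt_div (hasFDerivAt_const (-4 : ℝ) x) (hasFDerivAt_coord 2 x) hx.1
  refine h.congr_fderiv ?_
  ext v
  simp only [sub_apply, smul_apply, smul_eq_mul, proj_apply', zero_apply]
  ring

/-- **The derivative of the Slezkin flow.** -/
theorem hasFDerivAt_slezkinField (hx : x ∈ slezkinCone) :
    HasFDerivAt (slezkinField β)
      ((slezkinCoeff β x • (EuclideanSpace.proj 0 : E3 →L[ℝ] ℝ) + (x 0) • dCoeff β x).smulRight (EuclideanSpace.single 0 (1 : ℝ) : E3) +
        (slezkinCoeff β x • (EuclideanSpace.proj 1 : E3 →L[ℝ] ℝ) + (x 1) • dCoeff β x).smulRight (EuclideanSpace.single 1 (1 : ℝ) : E3) +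
        ((4 / x 2 ^ 2) • (EuclideanSpace.proj 2 : E3 →L[ℝ] ℝ)).smulRight (EuclideanSpace.single 2 (1 : ℝ) : E3))
      x :=
  (((hasFDerivAt_slezkinPlanar β hx 0).smul_const _).add ((hasFDerivAt_slezkinPlanar β hx 1).smul_const _)).add
    ((hasFDerivAt_slezkinVertical hx).smul_const _)

/-- `Dc_β(x) v` in coordinates. -/
theorem dCoeff_apply (v : E3) :
    dCoeff β x v = -(2 * (2 - β)) / (x 0 ^ 2 + x 1 ^ 2) ^ 2 * (x 0 * v 0 + x 1 * v 1) + 4 / x 2 ^ 3 * v 2 := by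
  simp only [dCoeff, add_apply, smul_apply, smul_eq_mul, proj_apply']

/-- **`Du_β(x) v` in coordinates.** -/
theorem fderiv_slezkinField_apply (hx : x ∈ slezkinCone) (v : E3) :
    fderiv ℝ (slezkinField β) x v =
      (slezkinCoeff β x * v 0 + x 0 * dCoeff β x v) • (EuclideanSpace.single 0 (1 : ℝ) : E3) +
        (slezkinCoeff β x * v 1 + x 1 * dCoeff β x v) • (EuclideanSpace.single 1 (1 : ℝ) : E3) +
        (4 / x 2 ^ 2 * v 2) • (EuclideanSpace.single 2 (1 : ℝ) : E3) := by
  rw [(hasFDerivAt_slezkinField β hx).fderiv]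
  simp only [add_apply, smul_apply, ContinuousLinearMap.smulRight_apply, smul_eq_mul,
    proj_apply']

/-- First coordinate of `Du_β(x) v`. -/
theorem fderiv_slezkinField_apply_zero (hx : x ∈ slezkinCone) (v : E3) :
    fderiv ℝ (slezkinField β) x v 0 = slezkinCoeff β x * v 0 + x 0 * dCoeff β x v := by
  rw [fderiv_slezkinField_apply β hx v]; simp

/-- Second coordinate of `Du_β(x) v`. -/
theorem fderiv_slezkinField_apply_one (hx : x ∈ slezkinCone) (v : E3) :
    fderiv ℝ (slezkinField β) x v 1 = slezkinCoeff β x * v 1 + x 1 * dCoeff β x v := by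
  rw [fderiv_slezkinField_apply β hx v]; simp

/-- Third coordinate of `Du_β(x) v`. -/
theorem fderiv_slezkinField_apply_two (hx : x ∈ slezkinCone) (v : E3) :
    fderiv ℝ (slezkinField β) x v 2 = 4 / x 2 ^ 2 * v 2 := by
  rw [fderiv_slezkinField_apply β hx v]; simp

/-! ### Divergence, curl, unthreadedness, homogeneity -/

/-- **`div u_β = 0`.** -/
theorem divergence_slezkinField (hx : x ∈ slezkinCone) :
    Literature.Analysis.FluidPDE.VectorCalculus.divergence (slezkinField β) x = 0 := by
  obtain ⟨hz, hρ⟩ := hx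
  rw [divergence_eq_sum_inner_fderiv (EuclideanSpace.basisFun (Fin 3) ℝ)]
  simp only [Fin.sum_univ_three, EuclideanSpace.basisFun_apply, EuclideanSpace.inner_single_left, map_one, one_mul]
  rw [fderiv_slezkinField_apply_zero β ⟨hz, hρ⟩, fderiv_slezkinField_apply_one β ⟨hz, hρ⟩, fderiv_slezkinField_apply_two β ⟨hz, hρ⟩,
    dCoeff_apply, dCoeff_apply, slezkinCoeff]
  simp
  field_simp
  ring

/-- **`curl u_β (x) = (4/x₂³)(−x₁, x₀, 0)`** — the azimuthal vorticity. -/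
theorem curl_slezkinField (hx : x ∈ slezkinCone) :
    curl (slezkinField β) x =
      (-(4 * x 1 / x 2 ^ 3)) • (EuclideanSpace.single 0 (1 : ℝ) : E3) + (4 * x 0 / x 2 ^ 3) • (EuclideanSpace.single 1 (1 : ℝ) : E3) := by
  have h0 := fun v => fderiv_slezkinField_apply_zero β hx v
  have h1 := fun v => fderiv_slezkinField_apply_one β hx v
  have h2 := fun v => fderiv_slezkinField_apply_two β hx v
  ext i
  fin_cases i
  · simp [curl, h0, h1, h2, dCoeff_apply]
    ring
  · simp [curl, h0, h1, h2, dCoeff_apply]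
    ring
  · simp [curl, h0, h1, h2, dCoeff_apply]
    ring

/-- ★ **The Slezkin flow is UNTHREADED about the vertex**: `⟪x, curl u_β x⟫ = 0`. -/
theorem inner_self_curl_slezkinField (hx : x ∈ slezkinCone) : ⟪x - 0, curl (slezkinField β) x⟫ = 0 := by
  rw [sub_zero, curl_slezkinField β hx, inner_add_right, inner_smul_right, inner_smul_right, EuclideanSpace.inner_single_right,
    EuclideanSpace.inner_single_right]
  simp
  ring

/-- The Slezkin flow is ROTATIONAL at every point of the cone. -/
theorem curl_slezkinField_ne_zero (hx : x ∈ slezkinCone) : curl (slezkinField β) x ≠ 0 := by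
  obtain ⟨hz, hρ⟩ := hx
  intro h
  have h0 : curl (slezkinField β) x 0 = 0 := by rw [h]; rfl
  have h1 : curl (slezkinField β) x 1 = 0 := by rw [h]; rfl
  rw [curl_slezkinField β ⟨hz, hρ⟩] at h0 h1
  simp at h0 h1
  have hx1 : x 1 = 0 := by
    rcases h0 with h | h
    · exact h
    · exact absurd h hz
  have hx0 : x 0 = 0 := by
    rcases h1 with h | h
    · exact h
    · exact absurd h hz
  exact hρ (by rw [hx0, hx1]; ring)

/-- ★ **The Slezkin flow is HOMOGENEOUS OF DEGREE `−1` about the vertex**: `Du_β(x) x = −u_β(x)`. -/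
theorem fderiv_slezkinField_apply_self (hx : x ∈ slezkinCone) :
    fderiv ℝ (slezkinField β) x (x - 0) = -slezkinField β x := by
  obtain ⟨hz, hρ⟩ := hx
  rw [sub_zero, fderiv_slezkinField_apply β ⟨hz, hρ⟩ x]
  ext i
  fin_cases i
  · simp [slezkinField, dCoeff_apply, slezkinCoeff]
    field_simp
    ring
  · simp [slezkinField, dCoeff_apply, slezkinCoeff]
    field_simp
    ring
  · simp [slezkinField]
    field_simp

/-! ### The vorticity field and the Laplacian -/

/-- **The curl of the vorticity field** `w(y) = (4/y₂³)(−y₁, y₀, 0)`: `curl w (x) = (12x₀/x₂⁴, 12x₁/x₂⁴, 8/x₂³)`. -/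
theorem curl_slezkinVort {w : E3 → E3}
    (hw : w = fun y : E3 =>
      (-(4 * y 1 / y 2 ^ 3)) • (EuclideanSpace.single 0 (1 : ℝ) : E3) + (4 * y 0 / y 2 ^ 3) • (EuclideanSpace.single 1 (1 : ℝ) : E3))
    (hx : x ∈ slezkinCone) :
    curl w x = (12 * x 0 / x 2 ^ 4) • (EuclideanSpace.single 0 (1 : ℝ) : E3) + (12 * x 1 / x 2 ^ 4) • (EuclideanSpace.single 1 (1 : ℝ) : E3) +
      (8 / x 2 ^ 3) • (EuclideanSpace.single 2 (1 : ℝ) : E3) := by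
  have hz : x 2 ≠ 0 := hx.1
  have hz3 : x 2 ^ 3 ≠ 0 := pow_ne_zero 3 hz
  have hA : HasFDerivAt (fun y : E3 => -(4 * y 1 / y 2 ^ 3))
      (-((4 / x 2 ^ 3) • (EuclideanSpace.proj 1 : E3 →L[ℝ] ℝ) - (12 * x 1 / x 2 ^ 4) • (EuclideanSpace.proj 2 : E3 →L[ℝ] ℝ))) x := by
    have h := (hasFDerivAt_div ((hasFDerivAt_coord 1 x).const_mul 4) ((hasFDerivAt_coord 2 x).pow 3) hz3).neg
    refine h.congr_fderiv ?_
    ext v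
    simp only [neg_apply, sub_apply, smul_apply, smul_eq_mul, proj_apply']
    simp
    field_simp
    ring
  have hB : HasFDerivAt (fun y : E3 => 4 * y 0 / y 2 ^ 3)
      ((4 / x 2 ^ 3) • (EuclideanSpace.proj 0 : E3 →L[ℝ] ℝ) - (12 * x 0 / x 2 ^ 4) • (EuclideanSpace.proj 2 : E3 →L[ℝ] ℝ)) x := by
    have h := hasFDerivAt_div ((hasFDerivAt_coord 0 x).const_mul 4) ((hasFDerivAt_coord 2 x).pow 3) hz3
    refine h.congr_fderiv ?_
    ext v
    simp only [sub_apply, smul_apply, smul_eq_mul, proj_apply']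
    simp
    field_simp
    ring
  have hD : HasFDerivAt w
      ((-((4 / x 2 ^ 3) • (EuclideanSpace.proj 1 : E3 →L[ℝ] ℝ) - (12 * x 1 / x 2 ^ 4) • (EuclideanSpace.proj 2 : E3 →L[ℝ] ℝ))).smulRight
          (EuclideanSpace.single 0 (1 : ℝ) : E3) +
        ((4 / x 2 ^ 3) • (EuclideanSpace.proj 0 : E3 →L[ℝ] ℝ) - (12 * x 0 / x 2 ^ 4) • (EuclideanSpace.proj 2 : E3 →L[ℝ] ℝ)).smulRight
          (EuclideanSpace.single 1 (1 : ℝ) : E3)) x := by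
    rw [hw]
    exact (hA.smul_const _).add (hB.smul_const _)
  have h0 : ∀ v : E3, fderiv ℝ w x v 0 = -(4 / x 2 ^ 3 * v 1 - 12 * x 1 / x 2 ^ 4 * v 2) := fun v => by
    rw [hD.fderiv]
    simp
  have h1 : ∀ v : E3, fderiv ℝ w x v 1 = 4 / x 2 ^ 3 * v 0 - 12 * x 0 / x 2 ^ 4 * v 2 := fun v => by
    rw [hD.fderiv]
    simp
  have h2 : ∀ v : E3, fderiv ℝ w x v 2 = 0 := fun v => by
    rw [hD.fderiv]
    simp
  ext i
  fin_cases i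
  · simp [curl, h0, h1, h2]
  · simp [curl, h0, h1, h2]
  · simp [curl, h0, h1, h2]
    ring

/-- The planar coefficient is analytic on the cone. -/
theorem analyticAt_slezkinCoeff (hx : x ∈ slezkinCone) : AnalyticAt ℝ (slezkinCoeff β) x :=
  (analyticAt_const.div (analyticAt_cylSq x) hx.2).sub (analyticAt_const.div ((analyticAt_coord 2 x).pow 2) (pow_ne_zero 2 hx.1))

/-- The Slezkin flow is analytic on the cone. -/
theorem analyticAt_slezkinField (hx : x ∈ slezkinCone) : AnalyticAt ℝ (slezkinField β) x :=
  ((((analyticAt_slezkinCoeff β hx).mul (analyticAt_coord 0 x)).smul analyticAt_const).add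
    (((analyticAt_slezkinCoeff β hx).mul (analyticAt_coord 1 x)).smul analyticAt_const)).add
    ((analyticAt_const.div (analyticAt_coord 2 x) hx.1).smul analyticAt_const)

/-- A ball about a point of the cone inside the cone. -/
theorem exists_ball_subset_slezkinCone (hx : x ∈ slezkinCone) : ∃ r > 0, ball x r ⊆ slezkinCone :=
  Metric.isOpen_iff.mp isOpen_slezkinCone x hx

/-- **`Δu_β(x) = −(12x₀/x₂⁴, 12x₁/x₂⁴, 8/x₂³)`** by the local `Δ = −curl curl`. -/
theorem laplacian_slezkinField (hx : x ∈ slezkinCone) :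
    Laplacian.laplacian (slezkinField β) x =
      -((12 * x 0 / x 2 ^ 4) • (EuclideanSpace.single 0 (1 : ℝ) : E3) + (12 * x 1 / x 2 ^ 4) • (EuclideanSpace.single 1 (1 : ℝ) : E3) +
        (8 / x 2 ^ 3) • (EuclideanSpace.single 2 (1 : ℝ) : E3)) := by
  obtain ⟨r, hr, hball⟩ := exists_ball_subset_slezkinCone hx
  rw [LocalCurlCurl.laplacian_eq_neg_curl_local hr
    (fun y hy => ((analyticAt_slezkinField β (hball hy)).contDiffAt (n := 2)).contDiffWithinAt)
    (fun y hy => divergence_slezkinField β (hball hy))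
    (w := fun y : E3 =>
      (-(4 * y 1 / y 2 ^ 3)) • (EuclideanSpace.single 0 (1 : ℝ) : E3) + (4 * y 0 / y 2 ^ 3) • (EuclideanSpace.single 1 (1 : ℝ) : E3))
    (fun y hy => curl_slezkinField β (hball hy)),
    curl_slezkinVort rfl hx]

end Summit.NavierStokesRegularity.NavierStokesRegularity.Theorems.PoloidalLiouville.AzimuthalCartan

end
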